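import Summits.RiemannHypothesis.RiemannHypothesis.Theorems.Splittings.LinearRayTwoPoint
import Summits.RiemannHypothesis.RiemannHypothesis.Theorems.LaplaceLoophole.Negative.LaplaceLoopholeWideWindow
import Literature.NumberTheory.LFunctions.RHWave0HardyProofs
import Literature.NumberTheory.LFunctions.DeBruijnHZeroProofs
import Literature.NumberTheory.LFunctions.RiemannXiProofs
import Summits.RiemannHypothesis.RiemannHypothesis.Theorems.CofiniteCriticalLine.Negative.CollarCostume
import HarnessLib

/-!
# RiemannHypothesis / Splittings — the WIDE WINDOW of the linear ray is closed:
`linearFactorH a` has a non-real zero for `0 < |a| < π/8` whenever `∫₀^∞ H_0 cosh(a·) ≠ 0`,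
unconditionally for `0 < |a| ≤ 0.3188`

Cell `rh-split`, family dbn × lens neg (cheap refutation of a conjunct).  The conjunct is the
*linear-factor route* of `Literature/Barriers/RiemannHypothesis/NewmanConjecture.lean`:
`HasOnlyRealZeros (linearFactorH a)`, where `linearFactorH a = G_a/a` and
`G_a := F_a' + a F_a`, `F_a = deBruijnHDiv (1 + u²/a²)` (`linearFactorH_eq_inv_mul_rayG`).  It IMPLIES RH
(`riemannHypothesis_of_linearRay`, landed) — an RH-strengthening — and is refuted here on the wide
window by three real-axis facts, none of which is a statement about off-line zeta zeros:

* `not_linearRay_of_two_zeros` — **two-zero certificate** (no signs, no `x ≥ 0`): if `Re G_a ≠ 0` on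
  `[x, x']` and `H_0(x) = H_0(x') = 0` (`x < x'`), the ray is false.  Under the ray Laguerre gives
  `(Re G_a'/Re G_a)' ≤ 0`, and `Re G_a' = a Re G_a − a² Re H_0` (`re_deriv_rayG`), so `Re H_0/Re G_a` is
  non-decreasing on `[x, x']`; vanishing at both ends it vanishes identically, so `H_0 ≡ 0` on a segment,
  hence on `ℂ` (identity theorem) — against `H_0(0) ≠ 0`.
* `tendsto_rayG_mul_exp_atBot` — **the left tail is a pure exponential**:
  `e^{−ax} G_a(x) → 2a² ∫₀^∞ H_0(t) cosh(at) dt` as `x → −∞` (`0 < a < π/8`), from the tree's integrated ODE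
  `UniversalFactor.laplaceG_eq` / `laplaceG_pos_eq`, evenness of `H_0` and its decay `e^{−b|x|}`, `b < π/8`.
  Hence `Re G_a ≠ 0` on a whole left half-line when the residue is non-zero.
* `exists_two_zeros_deBruijnH_zero_le` — **Hardy 1914**: `H_0` has two zeros below any `X`
  (the landed `CofiniteCriticalLine.Negative.exists_zero_on_line_abs_im_ge` = Hardy + discreteness of zeta zeros, `H_0(z) = ξ(1/2 + iz/2)/8`,
  evenness).

Main results: `not_hasOnlyRealZeros_linearFactorH_of_coshIntegral_ne_zero` (`0 < |a| < π/8`, residue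
`≠ 0`) and, by the tree's kernel-checked theta cells `UniversalFactor.PhiICert.re_tsum_pos_wide`
(`Re Φ_ℂ(ia) > 0` for `0 ≤ a ≤ 0.3188`) with `UniversalFactor.coshIntegral_ne_zero_of_re_tsum_ne_zero`,
the unconditional `not_hasOnlyRealZeros_linearFactorH_of_abs_le`: **for every `0 < |a| ≤ 0.3188` the
linear-factor deformation `linearFactorH a` has a non-real zero.**  The mechanism differs from the barrier
audit's Hadamard-free sketch (vertical growth at height `i`, existence of a zero of `G_a`): everything
happens on the real axis.  What stays OPEN: `|a| ≥ π/8` (both tails oscillate) and the residue zero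
`a₀ = 0.3194…`; `0.3188 < |a| < π/8`, `a ≠ a₀` needs only a certified sign of `Φ(ia)`.

Filed by rh-split-typer-1 g2 (lead g2 P1 routing 22:58Z) from dbn-neg g3's `HOME/rh-split-dbn-neg/LinearRayWideWindow.lean`
(sha16 80b78736835db876; proofs verbatim; the Hardy-height lemma is the landed one of `CollarCostume.lean` instead of a
restatement); typer replay rc 0, 0 warnings, 0 sorry, `#print axioms not_hasOnlyRealZeros_linearFactorH_of_abs_le` = std.

HONEST LABEL: a refutation of an RH-STRENGTHENING conjunct; it says nothing about the truth of RH.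

References: G. H. Hardy, C. R. Acad. Sci. Paris 158 (1914); N. G. de Bruijn, Duke Math. J. 17 (1950);
D. A. Cardon, Proc. AMS 130 (2002) §3; J. C. Lagarias – D. Montague, Mosc. J. Comb. Number Theory 1
(2011), Thm. 2.1 (the endpoint/residue mechanism one pole up).
-/

noncomputable section

set_option linter.dupNamespace false

namespace Summit.RiemannHypothesis.RiemannHypothesis.Theorems.Splittings.LinearRayWideWindow

open Complex Filter Topology MeasureTheory Set
open Literature.NumberTheory.LFunctions Literature.Analysis.Complex
open Literature.Barriers.RiemannHypothesis (linearFactorH linearFactorH_eq_deBruijnHDiv_add_deriv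
  hasOnlyRealZeros_linearFactorH_neg_iff)
open Summit.RiemannHypothesis.RiemannHypothesis.Theorems
open Summit.RiemannHypothesis.RiemannHypothesis.Theorems.Splittings.LinearRayTwoPoint
open Summit.RiemannHypothesis.Cruxes.CofiniteCriticalLine.Negative (exists_zero_on_line_abs_im_ge)

/-! ## Stage A′ — the two-zero certificate (no sign information, any real window) -/

/-- **Two-zero certificate.**  If `a ≠ 0`, `x < x'`, `Re G_a` does not vanish on `[x, x']` and
`H_0(x) = H_0(x') = 0`, then `linearFactorH a` has a non-real zero.  Under the ray, Laguerre gives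
`(v/u)' ≤ 0` with `u = Re G_a`, `v = Re G_a' = a u − a² Re H_0`; so `Re H_0/u` is non-decreasing on
`[x, x']`, vanishes at the ends, hence everywhere on the segment; `H_0` real on `ℝ` and entire forces
`H_0 ≡ 0`, contradicting `H_0(0) ≠ 0`. [folklore] -/
theorem not_linearRay_of_two_zeros {a x x' : ℝ} (ha : a ≠ 0) (hxx' : x < x')
    (hune : ∀ s ∈ Icc x x', ((deriv (deBruijnHDiv fun u : ℝ => 1 + u ^ 2 / a ^ 2) s +
      (a : ℂ) * deBruijnHDiv (fun u : ℝ => 1 + u ^ 2 / a ^ 2) s)).re ≠ 0)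
    (hHx : deBruijnH 0 (x : ℂ) = 0) (hHx' : deBruijnH 0 (x' : ℂ) = 0) :
    ¬ HasOnlyRealZeros (linearFactorH a) := by
  intro hZ
  set u : ℝ → ℝ := fun t ↦ ((deriv (deBruijnHDiv fun u : ℝ => 1 + u ^ 2 / a ^ 2) t +
    (a : ℂ) * deBruijnHDiv (fun u : ℝ => 1 + u ^ 2 / a ^ 2) t)).re with hu
  set v : ℝ → ℝ := fun t ↦ (deriv (fun z : ℂ => deriv (deBruijnHDiv fun u : ℝ => 1 + u ^ 2 / a ^ 2) z +
    (a : ℂ) * deBruijnHDiv (fun u : ℝ => 1 + u ^ 2 / a ^ 2) z) t).re with hv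
  set w : ℝ → ℝ := fun t ↦ (deriv (deriv (fun z : ℂ => deriv (deBruijnHDiv fun u : ℝ => 1 + u ^ 2 / a ^ 2) z +
    (a : ℂ) * deBruijnHDiv (fun u : ℝ => 1 + u ^ 2 / a ^ 2) z)) t).re with hw
  have hu' : ∀ s : ℝ, HasDerivAt u (v s) s := fun s ↦ hasDerivAt_re_rayG a s
  have hv' : ∀ s : ℝ, HasDerivAt v (w s) s := fun s ↦ hasDerivAt_re_deriv_rayG a s
  have hLag : ∀ s : ℝ, u s * w s ≤ v s ^ 2 := fun s ↦ laguerre_rayG ha hZ s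
  have hune' : ∀ s ∈ Icc x x', u s ≠ 0 := fun s hs ↦ hune s hs
  have hvval : ∀ s : ℝ, v s = a * u s - a ^ 2 * (deBruijnH 0 s).re := fun s ↦ re_deriv_rayG ha s
  -- ψ := v / u is antitone on [x, x']
  set ψ : ℝ → ℝ := fun t ↦ v t / u t with hψ
  have hψ' : ∀ s ∈ Icc x x', HasDerivAt ψ ((w s * u s - v s * v s) / u s ^ 2) s := fun s hs ↦
    (hv' s).div (hu' s) (hune' s hs)
  have hanti : AntitoneOn ψ (Icc x x') := by
    refine antitoneOn_of_deriv_nonpos (convex_Icc x x')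
      (fun s hs ↦ (hψ' s hs).continuousAt.continuousWithinAt)
      (fun s hs ↦ (hψ' s (interior_subset hs)).differentiableAt.differentiableWithinAt)
      fun s hs ↦ ?_
    rw [(hψ' s (interior_subset hs)).deriv]
    exact div_nonpos_of_nonpos_of_nonneg (by nlinarith [hLag s]) (sq_nonneg _)
  have hψval : ∀ s ∈ Icc x x', ψ s = a - a ^ 2 * ((deBruijnH 0 s).re / u s) := fun s hs ↦ by
    have hne : u s ≠ 0 := hune' s hs
    simp only [hψ]
    rw [hvval s]
    field_simp
  have ha2 : 0 < a ^ 2 := lt_of_le_of_ne (sq_nonneg a) (Ne.symm (pow_ne_zero 2 ha))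
  -- φ := Re H_0 / u is non-decreasing on [x, x']
  have hmono : ∀ s ∈ Icc x x', ∀ s' ∈ Icc x x', s ≤ s' →
      (deBruijnH 0 s).re / u s ≤ (deBruijnH 0 s').re / u s' := by
    intro s hs s' hs' hss'
    have h := hanti hs hs' hss'
    rw [hψval s hs, hψval s' hs'] at h
    exact le_of_mul_le_mul_left (by linarith) ha2
  -- hence `H_0 = 0` on the whole segment
  have hxm : x ∈ Icc x x' := ⟨le_rfl, hxx'.le⟩
  have hx'm : x' ∈ Icc x x' := ⟨hxx'.le, le_rfl⟩
  have hzero : ∀ s ∈ Icc x x', deBruijnH 0 (s : ℂ) = 0 := by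
    intro s hs
    have h1 := hmono x hxm s hs hs.1
    have h2 := hmono s hs x' hx'm hs.2
    rw [hHx, Complex.zero_re, zero_div] at h1
    rw [hHx', Complex.zero_re, zero_div] at h2
    have hre : (deBruijnH 0 s).re = 0 := by
      have h0 : (deBruijnH 0 s).re / u s = 0 := le_antisymm h2 h1
      rcases div_eq_zero_iff.1 h0 with h | h
      · exact h
      · exact absurd h (hune' s hs)
    have him : (deBruijnH 0 s).im = 0 := by
      rw [← deBruijnHDiv_one']; exact deBruijnHDiv_ofReal_im _ s
    exact Complex.ext (by simpa using hre) (by simpa using him)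
  -- identity theorem: `H_0` vanishes on a real segment, hence on `ℂ`; but `H_0(0) ≠ 0`
  have hanalytic : AnalyticOnNhd ℂ (deBruijnH 0) univ := fun z _ ↦
    (differentiable_deBruijnH_holds 0).analyticAt z
  have hfreq : ∃ᶠ z in 𝓝[≠] ((x : ℝ) : ℂ), deBruijnH 0 z = 0 := by
    rw [frequently_nhdsWithin_iff]
    refine Filter.frequently_iff.2 fun {U} hU ↦ ?_
    obtain ⟨δ, hδ, hball⟩ := Metric.mem_nhds_iff.1 hU
    have hmin : 0 < min (δ / 2) ((x' - x) / 2) := lt_min (by linarith) (by linarith)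
    have hsI : x + min (δ / 2) ((x' - x) / 2) ∈ Icc x x' :=
      ⟨by linarith, by linarith [min_le_right (δ / 2) ((x' - x) / 2)]⟩
    refine ⟨((x + min (δ / 2) ((x' - x) / 2) : ℝ) : ℂ), hball ?_, hzero _ hsI, ?_⟩
    · rw [Metric.mem_ball, Complex.dist_eq, ← Complex.ofReal_sub, Complex.norm_real, Real.norm_eq_abs,
        add_sub_cancel_left, abs_of_pos hmin]
      linarith [min_le_left (δ / 2) ((x' - x) / 2)]
    · rw [mem_compl_singleton_iff]
      intro h
      have h' := Complex.ofReal_injective h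
      linarith
  have hEq := hanalytic.eqOn_zero_of_preconnected_of_frequently_eq_zero isPreconnected_univ
    (mem_univ _) hfreq
  exact deBruijnH_apply_zero_ne_zero 0 (by simpa using hEq (mem_univ (0 : ℂ)))

/-! ## Hardy's theorem: two zeros of `H_0` below any abscissa -/

-- Zeros of `ζ` on the critical line of arbitrarily large height (Hardy 1914 + discreteness): the landed
-- `Summit.RiemannHypothesis.Cruxes.CofiniteCriticalLine.Negative.exists_zero_on_line_abs_im_ge` (CollarCostume.lean).

/-- A critical zero `1/2 + it` of `ζ` is the real zero `2t` of `H_0` (`H_0(z) = ξ(1/2 + iz/2)/8`,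
`ξ(s) = 0` at the non-trivial zeros). [cite: Titchmarsh1986, §10.1] -/
theorem deBruijnH_zero_two_mul_eq_zero {t : ℝ} (ht : riemannZeta (1 / 2 + t * I) = 0) :
    deBruijnH 0 ((2 * t : ℝ) : ℂ) = 0 := by
  have hH : deBruijnH 0 ((2 * t : ℝ) : ℂ) = riemannXi (1 / 2 + I * ((2 * t : ℝ) : ℂ) / 2) / 8 :=
    deBruijnH_zero_eq_holds _
  have hs : (1 / 2 : ℂ) + I * ((2 * t : ℝ) : ℂ) / 2 = 1 / 2 + t * I := by push_cast; ring
  rw [hH, hs, riemannXi_eq_zero_of_nontrivial ht ?_ ?_, zero_div]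
  · rintro ⟨n, hn⟩
    have h := congrArg Complex.re hn
    simp at h
    linarith [n.cast_nonneg (α := ℝ)]
  · intro h
    have h := congrArg Complex.re h
    simp at h

/-- `H_0` is even on the real axis. [folklore] -/
theorem deBruijnH_zero_ofReal_neg (s : ℝ) : deBruijnH 0 ((-s : ℝ) : ℂ) = deBruijnH 0 (s : ℂ) := by
  rw [Complex.ofReal_neg, deBruijnH_neg]

/-- **Two zeros of `H_0` far to the left**: for every `X` there are `x < x' ≤ X` with
`H_0(x) = H_0(x') = 0` (Hardy's theorem, twice; `H_0` is even). [cite: Hardy1914, C. R. Acad. Sci. Paris 158] -/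
theorem exists_two_zeros_deBruijnH_zero_le (X : ℝ) :
    ∃ x x' : ℝ, x < x' ∧ x' ≤ X ∧ deBruijnH 0 (x : ℂ) = 0 ∧ deBruijnH 0 (x' : ℂ) = 0 := by
  have hzero : ∀ t : ℝ, riemannZeta (1 / 2 + t * I) = 0 → deBruijnH 0 ((-(2 * |t|) : ℝ) : ℂ) = 0 := by
    intro t ht
    rw [deBruijnH_zero_ofReal_neg]
    rcases abs_choice t with h | h
    · rw [h]; exact deBruijnH_zero_two_mul_eq_zero ht
    · rw [h, show (2 * -t : ℝ) = -(2 * t) by ring, deBruijnH_zero_ofReal_neg]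
      exact deBruijnH_zero_two_mul_eq_zero ht
  obtain ⟨t₁, ht₁, hz₁⟩ := exists_zero_on_line_abs_im_ge (-X / 2)
  obtain ⟨t₂, ht₂, hz₂⟩ := exists_zero_on_line_abs_im_ge (|t₁| + 1)
  exact ⟨-(2 * |t₂|), -(2 * |t₁|), by linarith, by linarith, hzero t₂ hz₂, hzero t₁ hz₁⟩

/-! ## The left tail of `G_a` is a pure exponential -/

/-- Reflection `t ↦ −t` in the interval integral of `H_0(t)e^{−at}` (`H_0` is even). [folklore] -/
theorem intervalIntegral_deBruijnH_zero_mul_exp_reflect (a x : ℝ) :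
    (∫ t in (0 : ℝ)..x, deBruijnH 0 t * (Real.exp (-(a * t)) : ℂ)) =
      -∫ s in (0 : ℝ)..-x, deBruijnH 0 s * (Real.exp (-(-a * s)) : ℂ) := by
  set h : ℝ → ℂ := fun s ↦ deBruijnH 0 s * (Real.exp (-(-a * s)) : ℂ) with hh
  have h1 : (∫ t in (0 : ℝ)..x, deBruijnH 0 t * (Real.exp (-(a * t)) : ℂ)) =
      ∫ t in (0 : ℝ)..x, h (-t) := by
    refine intervalIntegral.integral_congr fun t _ ↦ ?_
    simp only [hh, Complex.ofReal_neg, deBruijnH_neg, neg_mul, mul_neg, neg_neg]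
  rw [h1, intervalIntegral.integral_comp_neg, neg_zero, intervalIntegral.integral_symm]

/-- **Left tail of `G_a`** (`0 < a < π/8`): `e^{−ax} G_a(x) → 2a² ∫₀^∞ H_0(t) cosh(at) dt` as
`x → −∞`.  From `laplaceG_eq` (`c = a`): `e^{−ax}G_a(x) = G_a(0) − a²∫₀ˣ H_0 e^{−at}`, the value
`G_a(0) = a²∫₀^∞ H_0 e^{−at}` (`laplaceG_pos_eq`), and `∫ₓ⁰ H_0(t)e^{−at} dt = ∫₀^{−x} H_0(s)e^{as} ds →
∫₀^∞ H_0 e^{as}` (`H_0` even, `‖H_0(s)‖ ≤ Ce^{−b|s|}` with `a < b < π/8`). [folklore] -/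
theorem tendsto_rayG_mul_exp_atBot {a : ℝ} (ha : 0 < a) (hlt : a < Real.pi / 8) :
    Tendsto (fun x : ℝ => (deriv (deBruijnHDiv fun u : ℝ => 1 + u ^ 2 / a ^ 2) x +
        (a : ℂ) * deBruijnHDiv (fun u : ℝ => 1 + u ^ 2 / a ^ 2) x) * (Real.exp (-(a * x)) : ℂ)) atBot
      (𝓝 (2 * (a : ℂ) ^ 2 * ∫ t in Ioi (0 : ℝ), deBruijnH 0 (t : ℂ) * (Real.cosh (a * t) : ℂ))) := by
  have ha0 : a ≠ 0 := ha.ne'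
  obtain ⟨b, hab, hbπ⟩ := exists_between hlt
  obtain ⟨C, -, hC⟩ := UniversalFactor.exists_norm_deBruijnH_zero_le (b := b) (ha.trans hab).le hbπ
  obtain ⟨hintp, -⟩ := UniversalFactor.integrableOn_deBruijnH_zero_mul_exp (c := a) (b := b) (C := C)
    (by linarith) hC
  obtain ⟨hintm, -⟩ := UniversalFactor.integrableOn_deBruijnH_zero_mul_exp (c := -a) (b := b) (C := C)
    (by linarith) hC
  have h0raw := (UniversalFactor.laplaceG_pos_eq ha).2 0 le_rfl
  have hG := fun x : ℝ ↦ UniversalFactor.laplaceG_eq (c := a) ha0 rfl x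
  set Jp : ℂ := ∫ t in Ioi (0 : ℝ), deBruijnH 0 t * (Real.exp (-(a * t)) : ℂ) with hJp
  set Jm : ℂ := ∫ t in Ioi (0 : ℝ), deBruijnH 0 t * (Real.exp (-(-a * t)) : ℂ) with hJm
  -- the value at `0` (no growing mode)
  have h0 : deriv (deBruijnHDiv fun u : ℝ => 1 + u ^ 2 / a ^ 2) ((0 : ℝ) : ℂ) +
      (a : ℂ) * deBruijnHDiv (fun u : ℝ => 1 + u ^ 2 / a ^ 2) ((0 : ℝ) : ℂ) = (a : ℂ) ^ 2 * Jp := by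
    rw [← h0raw]; simp
  -- reflection `t ↦ −t` in the interval integral (`H_0` is even)
  have hrefl : ∀ x : ℝ, (∫ t in (0 : ℝ)..x, deBruijnH 0 t * (Real.exp (-(a * t)) : ℂ)) =
      -∫ s in (0 : ℝ)..-x, deBruijnH 0 s * (Real.exp (-(-a * s)) : ℂ) := fun x ↦
    intervalIntegral_deBruijnH_zero_mul_exp_reflect a x
  have hform : ∀ x : ℝ, (deriv (deBruijnHDiv fun u : ℝ => 1 + u ^ 2 / a ^ 2) x +
        (a : ℂ) * deBruijnHDiv (fun u : ℝ => 1 + u ^ 2 / a ^ 2) x) * (Real.exp (-(a * x)) : ℂ) =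
      (a : ℂ) ^ 2 * Jp + (a : ℂ) ^ 2 * ∫ s in (0 : ℝ)..-x, deBruijnH 0 s * (Real.exp (-(-a * s)) : ℂ) := by
    intro x
    rw [hG x, h0, hrefl x]; ring
  have hlim1 : Tendsto (fun x : ℝ => ∫ s in (0 : ℝ)..-x, deBruijnH 0 s * (Real.exp (-(-a * s)) : ℂ))
      atBot (𝓝 Jm) :=
    intervalIntegral_tendsto_integral_Ioi 0 hintm tendsto_neg_atBot_atTop
  have hlim : Tendsto (fun x : ℝ => (deriv (deBruijnHDiv fun u : ℝ => 1 + u ^ 2 / a ^ 2) x +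
        (a : ℂ) * deBruijnHDiv (fun u : ℝ => 1 + u ^ 2 / a ^ 2) x) * (Real.exp (-(a * x)) : ℂ)) atBot
      (𝓝 ((a : ℂ) ^ 2 * Jp + (a : ℂ) ^ 2 * Jm)) :=
    ((hlim1.const_mul ((a : ℂ) ^ 2)).const_add ((a : ℂ) ^ 2 * Jp)).congr fun x ↦ (hform x).symm
  -- `Jp + Jm = 2 ∫₀^∞ H_0 cosh(a·)`
  have hsum : Jp + Jm = 2 * ∫ t in Ioi (0 : ℝ), deBruijnH 0 (t : ℂ) * (Real.cosh (a * t) : ℂ) := by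
    rw [hJp, hJm, ← integral_add hintp hintm, ← integral_const_mul]
    refine setIntegral_congr_fun measurableSet_Ioi fun t _ ↦ ?_
    have hc : (Real.exp (-(a * t)) : ℂ) + (Real.exp (-(-a * t)) : ℂ) = 2 * (Real.cosh (a * t) : ℂ) := by
      have hr : Real.exp (-(a * t)) + Real.exp (-(-a * t)) = 2 * Real.cosh (a * t) := by
        rw [Real.cosh_eq, show -(-a * t) = a * t by ring]; ring
      exact_mod_cast hr
    rw [← mul_add, hc]; ring
  convert hlim using 2
  rw [← mul_add, hsum]; ring

/-- Hence, when the residue `∫₀^∞ H_0 cosh(a·)` is non-zero, `Re G_a` has NO zero on a left half-line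
(`G_a` is real on `ℝ`). [folklore] -/
theorem exists_re_rayG_ne_zero_left {a : ℝ} (ha : 0 < a) (hlt : a < Real.pi / 8)
    (hR : (∫ t in Ioi (0 : ℝ), deBruijnH 0 (t : ℂ) * (Real.cosh (a * t) : ℂ)) ≠ 0) :
    ∃ X : ℝ, ∀ x : ℝ, x ≤ X → ((deriv (deBruijnHDiv fun u : ℝ => 1 + u ^ 2 / a ^ 2) x +
      (a : ℂ) * deBruijnHDiv (fun u : ℝ => 1 + u ^ 2 / a ^ 2) x)).re ≠ 0 := by
  have hL : (2 * (a : ℂ) ^ 2 * ∫ t in Ioi (0 : ℝ), deBruijnH 0 (t : ℂ) * (Real.cosh (a * t) : ℂ)) ≠ 0 :=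
    mul_ne_zero (mul_ne_zero two_ne_zero (pow_ne_zero 2 (Complex.ofReal_ne_zero.2 ha.ne'))) hR
  obtain ⟨X, hX⟩ := Filter.eventually_atBot.1 ((tendsto_rayG_mul_exp_atBot ha hlt).eventually_ne hL)
  refine ⟨X, fun x hx h0 ↦ hX x hx ?_⟩
  have hg : deriv (deBruijnHDiv fun u : ℝ => 1 + u ^ 2 / a ^ 2) x +
      (a : ℂ) * deBruijnHDiv (fun u : ℝ => 1 + u ^ 2 / a ^ 2) x = 0 :=
    Complex.ext (by simpa using h0) (by simpa using rayG_ofReal_im a x)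
  rw [hg, zero_mul]

/-! ## The wide window of the linear ray -/

/-- **The wide window of the linear ray is closed off the residue zero** (`a > 0`): for
`0 < a < π/8` with `∫₀^∞ H_0(t) cosh(at) dt ≠ 0`, the linear-factor deformation `linearFactorH a` has a
non-real zero.  (Left tail one-signed, two Hardy zeros of `H_0` inside it, two-zero certificate.)
[folklore] -/
theorem not_hasOnlyRealZeros_linearFactorH_of_coshIntegral_ne_zero_pos {a : ℝ} (ha : 0 < a)
    (hlt : a < Real.pi / 8)
    (hR : (∫ t in Ioi (0 : ℝ), deBruijnH 0 (t : ℂ) * (Real.cosh (a * t) : ℂ)) ≠ 0) :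
    ¬ HasOnlyRealZeros (linearFactorH a) := by
  obtain ⟨X, hX⟩ := exists_re_rayG_ne_zero_left ha hlt hR
  obtain ⟨x, x', hxx', hx'X, hx, hx'⟩ := exists_two_zeros_deBruijnH_zero_le X
  exact not_linearRay_of_two_zeros ha.ne' hxx' (fun s hs ↦ hX s (hs.2.trans hx'X)) hx hx'

/-- The same for `0 < |a| < π/8` (mirror symmetry `hasOnlyRealZeros_linearFactorH_neg_iff`; the residue
is even in `a`).  This is the statement the barrier audit of `NewmanConjecture.lean` asks a prover to
land. [folklore] -/
theorem not_hasOnlyRealZeros_linearFactorH_of_coshIntegral_ne_zero {a : ℝ} (ha : a ≠ 0)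
    (hlt : |a| < Real.pi / 8)
    (hR : (∫ t in Ioi (0 : ℝ), deBruijnH 0 (t : ℂ) * (Real.cosh (a * t) : ℂ)) ≠ 0) :
    ¬ HasOnlyRealZeros (linearFactorH a) := by
  rcases lt_or_gt_of_ne ha with hneg | hpos
  · have h := not_hasOnlyRealZeros_linearFactorH_of_coshIntegral_ne_zero_pos (a := -a) (neg_pos.2 hneg)
      (by rwa [abs_of_neg hneg] at hlt) (by simpa only [neg_mul, Real.cosh_neg] using hR)
    rwa [hasOnlyRealZeros_linearFactorH_neg_iff] at h
  · exact not_hasOnlyRealZeros_linearFactorH_of_coshIntegral_ne_zero_pos hpos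
      (by rwa [abs_of_pos hpos] at hlt) hR

/-- **Unconditional window**: for every `0 < |a| ≤ 0.3188` the linear-factor deformation
`linearFactorH a` of `H_0` has a non-real zero — the residue is `(π/2)Φ_ℂ(i|a|)` with
`Re Φ_ℂ(i|a|) > 0` kernel-checked (`UniversalFactor.PhiICert.re_tsum_pos_wide`). [folklore] -/
theorem not_hasOnlyRealZeros_linearFactorH_of_abs_le {a : ℝ} (ha : a ≠ 0)
    (h1 : |a| ≤ 3188 / 10000) : ¬ HasOnlyRealZeros (linearFactorH a) := by
  have hπ : (3188 : ℝ) / 10000 < Real.pi / 8 := by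
    have := Real.pi_gt_three
    linarith
  have hlt : |a| < Real.pi / 8 := lt_of_le_of_lt h1 hπ
  refine not_hasOnlyRealZeros_linearFactorH_of_coshIntegral_ne_zero ha hlt ?_
  have hcert := UniversalFactor.coshIntegral_ne_zero_of_re_tsum_ne_zero (a := |a|) (by rwa [abs_abs])
    (UniversalFactor.PhiICert.re_tsum_pos_wide (abs_nonneg a) h1).ne'
  rcases abs_choice a with h | h
  · rwa [h] at hcert
  · simpa only [h, neg_mul, Real.cosh_neg] using hcert

/-- Headline form: a non-real zero of `linearFactorH a` for each `0 < |a| ≤ 0.3188`. [folklore] -/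
theorem exists_nonreal_zero_linearFactorH_of_abs_le {a : ℝ} (ha : a ≠ 0) (h1 : |a| ≤ 3188 / 10000) :
    ∃ z : ℂ, linearFactorH a z = 0 ∧ z.im ≠ 0 := by
  have h := not_hasOnlyRealZeros_linearFactorH_of_abs_le ha h1
  unfold HasOnlyRealZeros at h
  push Not at h
  exact h

/-- The splitting bookkeeping: on the unconditional window the conjunct of the linear-ray splitting
`LinearRay a ∧ (LinearRay a → RH)` is FALSE while its bridge `LinearRay a → RH`
(`riemannHypothesis_of_linearRay'`) is TRUE — so the splitting decides nothing about RH there. [folklore] -/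
theorem linearRay_splitting_vacuous_of_abs_le {a : ℝ} (ha : a ≠ 0) (h1 : |a| ≤ 3188 / 10000) :
    ¬ HasOnlyRealZeros (linearFactorH a) ∧
      (HasOnlyRealZeros (linearFactorH a) → Summit.RiemannHypothesis) :=
  ⟨not_hasOnlyRealZeros_linearFactorH_of_abs_le ha h1, riemannHypothesis_of_linearRay' ha⟩

end Summit.RiemannHypothesis.RiemannHypothesis.Theorems.Splittings.LinearRayWideWindow

end
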